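import Literature.NumberTheory.DiophantineGeometry.MultiplicativeGroupApproximationProp434Proofs
import HarnessLib

/-!
# Geometry of numbers in a finite-index sublattice of `ℤ^m`, weighted `ℓ¹` form (I): a short basis

Cell topic `Summits/ABC/StewartYu` (cell abc-stewartyu, seat p1); namespace
`Summit.ABC.StewartYu.PrincipalLattice` (theorems only). Part of work package WP-M (reduction of
`p`-adic linear forms in logarithms of primes to Kummer-free principal generators); the main theorem
is in `PadicLogFormsPrincipalReduction.lean`.

* `exists_seminorm_weighted` — the weighted `ℓ¹`-norm `F(x) = ∑ wᵢ|xᵢ|` (`wᵢ > 0`) as a definite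
  `Seminorm`;
* `volume_weighted_lt_one` / `_le_one` — the weighted cross-polytope `{∑ wᵢ|xᵢ| < 1}` has volume
  `2^m/(m! ∏ wᵢ)` (Mathlib's `volume_sum_rpow_lt_one`, `p = 1`, and a diagonal change of variables);
* `exists_basis_prod_weighted_le` — a finite-index `L ≤ ℤ^m` (index `d`) has a `ℤ`-basis with
  `∏ⱼ F(bⱼ) ≤ (m!)² d ∏ wᵢ`: Minkowski's second theorem and Mahler's basis theorem, both PROVED in
  the tree for `ℤ^m` (`Dioph.exists_directional_system_prod_mul_volume_le`
  [cite: EvertseGyory2015, Thm 4.3.1 (p. 70)], `Dioph.exists_int_basis_le_of_directional`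
  [cite: EvertseGyory2015, Thm 4.3.3 (p. 70)]), transported to `L` by a basis matrix.

## References

* [EvertseGyory2015] J.-H. Evertse, K. Győry, *Unit Equations in Diophantine Number Theory*,
  Cambridge Stud. Adv. Math. 146, CUP 2015 — Thm 4.3.1, Thm 4.3.3 (p. 70), Lemma 4.3.6 (p. 72).
-/

noncomputable section

namespace Summit.ABC.StewartYu.PrincipalLattice

open MeasureTheory Module Finset
open Literature.NumberTheory.DiophantineGeometry.Dioph

/-! ### The weighted `ℓ¹`-norm `F(x) = ∑ wᵢ |xᵢ|` on `ℝ^m`: seminorm, volume of its ball -/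

/-- The weighted `ℓ¹`-norm `x ↦ ∑ wᵢ |xᵢ|` (`wᵢ > 0`) is a norm on `ℝ^m`; packaged as the
existence of a definite `Seminorm` with this value. [folklore] -/
theorem exists_seminorm_weighted {m : ℕ} (w : Fin m → ℝ) (hw : ∀ i, 0 < w i) :
    ∃ F : Seminorm ℝ (Fin m → ℝ), (∀ x, F x = ∑ i, w i * |x i|) ∧ ∀ x, F x = 0 → x = 0 := by
  refine ⟨Seminorm.of (fun x => ∑ i, w i * |x i|) (fun x y => ?_) (fun a x => ?_),
    fun x => rfl, fun x hx => ?_⟩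
  · rw [← Finset.sum_add_distrib]
    refine Finset.sum_le_sum fun i _ => ?_
    rw [← mul_add]
    exact mul_le_mul_of_nonneg_left (abs_add_le _ _) (hw i).le
  · rw [Finset.mul_sum]
    refine Finset.sum_congr rfl fun i _ => ?_
    rw [Pi.smul_apply, smul_eq_mul, abs_mul, Real.norm_eq_abs]; ring
  · change ∑ i, w i * |x i| = 0 at hx
    rw [Finset.sum_eq_zero_iff_of_nonneg fun i _ => mul_nonneg (hw i).le (abs_nonneg _)] at hx
    funext i
    have := hx i (Finset.mem_univ i)
    rcases mul_eq_zero.mp this with h | h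
    · exact absurd h (hw i).ne'
    · exact abs_eq_zero.mp h

/-- **Volume of the weighted cross-polytope**: `vol {x ∈ ℝ^m : ∑ wᵢ|xᵢ| < 1} = 2^m/(m! ∏ wᵢ)`
(`wᵢ > 0`; the image of the cross-polytope `{∑ |cᵢ| < 1}`, of volume `2^m/m!` — Mathlib's
`volume_sum_rpow_lt_one` with `p = 1` —, under the diagonal map `cᵢ ↦ cᵢ/wᵢ`). [folklore] -/
theorem volume_weighted_lt_one {m : ℕ} (w : Fin m → ℝ) (hw : ∀ i, 0 < w i) :
    volume {x : Fin m → ℝ | ∑ i, w i * |x i| < 1} =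
      ENNReal.ofReal (2 ^ m / (m.factorial * ∏ i, w i)) := by
  set D : (Fin m → ℝ) →ₗ[ℝ] (Fin m → ℝ) := Matrix.toLin' (Matrix.diagonal w) with hD
  have hDapply : ∀ x i, D x i = w i * x i := by
    intro x i; rw [hD, Matrix.toLin'_apply, Matrix.mulVec_diagonal]
  have hdetD : LinearMap.det D = ∏ i, w i := by
    rw [hD, LinearMap.det_toLin', Matrix.det_diagonal]
  have hprod : 0 < ∏ i, w i := Finset.prod_pos fun i _ => hw i
  have hdet0 : LinearMap.det D ≠ 0 := by rw [hdetD]; exact hprod.ne'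
  have hset : {x : Fin m → ℝ | ∑ i, w i * |x i| < 1} = D ⁻¹' {c | ∑ i, |c i| < 1} := by
    ext x
    simp only [Set.mem_setOf_eq, Set.mem_preimage, hDapply, abs_mul, abs_of_pos (hw _)]
  rw [hset, MeasureTheory.Measure.addHaar_preimage_linearMap volume hdet0]
  have hcross : volume {c : Fin m → ℝ | ∑ i, |c i| < 1} =
      ENNReal.ofReal (2 ^ m / m.factorial) := by
    have h := MeasureTheory.volume_sum_rpow_lt_one (Fin m) (p := 1) le_rfl
    have hset' : {x : Fin m → ℝ | ∑ i, |x i| ^ (1 : ℝ) < 1} = {c | ∑ i, |c i| < 1} := by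
      ext x; simp only [Set.mem_setOf_eq, Real.rpow_one]
    rw [hset'] at h
    rw [h]
    have h2 : Real.Gamma 2 = 1 := by
      rw [show (2 : ℝ) = (1 : ℕ) + 1 by norm_num, Real.Gamma_nat_eq_factorial, Nat.factorial_one,
        Nat.cast_one]
    simp only [Fintype.card_fin, div_one, one_add_one_eq_two, h2, mul_one,
      Real.Gamma_nat_eq_factorial]
  rw [hcross, hdetD, ← ENNReal.ofReal_mul (abs_nonneg _), abs_inv, abs_of_pos hprod]
  congr 1
  field_simp

/-- The closed ball version: `vol {x : ∑ wᵢ|xᵢ| ≤ 1} = 2^m/(m! ∏ wᵢ)` (`m ≥ 1`). [folklore] -/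
theorem volume_weighted_le_one {m : ℕ} (hm : 0 < m) (w : Fin m → ℝ) (hw : ∀ i, 0 < w i) :
    volume {x : Fin m → ℝ | ∑ i, w i * |x i| ≤ 1} =
      ENNReal.ofReal (2 ^ m / (m.factorial * ∏ i, w i)) := by
  obtain ⟨F, hF, hF0⟩ := exists_seminorm_weighted w hw
  haveI : Nontrivial (Fin m → ℝ) := by
    haveI : Nonempty (Fin m) := ⟨⟨0, hm⟩⟩
    infer_instance
  have h := MeasureTheory.measure_le_eq_lt volume (map_zero F) (fun z => map_neg_eq_map F z)
    (fun z w => map_add_le_add F z w) (fun {z} hz => hF0 z hz)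
    (fun r z => (map_smul_eq_mul F r z).le.trans_eq (by rw [Real.norm_eq_abs])) 1
  simp only [hF] at h
  rw [h, volume_weighted_lt_one w hw]

/-! ### Geometry of numbers in a finite-index sublattice of `ℤ^m`, weighted `ℓ¹` form -/

/-- **A `ℤ`-basis of a finite-index sublattice with small weighted norms** (Minkowski's second
theorem and Mahler's basis theorem, both PROVED in the tree for `ℤ^m`:
`Dioph.exists_directional_system_prod_mul_volume_le` [Evertse–Győry Thm 4.3.1] and
`Dioph.exists_int_basis_le_of_directional` [Thm 4.3.3]). For `L ≤ ℤ^m` (`m ≥ 1`) of finite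
index `d` and weights `wᵢ > 0`, `L` has a `ℤ`-basis `b` with
`∏ⱼ F(bⱼ) ≤ (m!)² · d · ∏ᵢ wᵢ`, `F(x) = ∑ᵢ wᵢ |xᵢ|` — transport `F` to `ℤ^m ≅ L` through a basis
matrix `B` (`|det B| = d`); the unit ball of `F ∘ B` has volume `2^m / (m! · d · ∏ wᵢ)`,
Minkowski gives a directional system `v` with `∏ F(Bv_k) ≤ m! d ∏ wᵢ`, Mahler a basis `y` of
`ℤ^m` with `F(By_j) ≤ (j+1) F(Bv_j)`, and `b_j = B y_j`. [folklore] -/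
theorem exists_basis_prod_weighted_le {m : ℕ} (hm : 0 < m) (L : Submodule ℤ (Fin m → ℤ))
    [Finite ((Fin m → ℤ) ⧸ L)] (w : Fin m → ℝ) (hw : ∀ i, 0 < w i) :
    ∃ b : Module.Basis (Fin m) ℤ L,
      ∏ j, (∑ i, w i * |(((b j : L) : Fin m → ℤ) i : ℝ)|) ≤
        (m.factorial : ℝ) ^ 2 * Nat.card ((Fin m → ℤ) ⧸ L) * ∏ i, w i := by
  classical
  -- full rank and a basis
  have hrank : Module.finrank ℤ L = m := by
    have h := (Submodule.finiteQuotient_iff L).mp ‹_›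
    rw [h, Module.finrank_fin_fun]
  let bN : Module.Basis (Fin m) ℤ L := Module.finBasisOfFinrankEq ℤ L hrank
  -- the matrix of the basis (columns) and its determinant
  set B : Matrix (Fin m) (Fin m) ℤ := Matrix.of fun i k => ((bN k : L) : Fin m → ℤ) i with hB
  have hdet : B.det.natAbs = Nat.card ((Fin m → ℤ) ⧸ L) := by
    have h := Submodule.natAbs_det_basis_change (Pi.basisFun ℤ (Fin m)) L bN
    rw [Module.Basis.det_apply] at h
    rw [← h]
    congr 2
  have hcard_pos : 0 < Nat.card ((Fin m → ℤ) ⧸ L) := Nat.card_pos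
  have hdet0 : B.det ≠ 0 := by
    intro h0; rw [h0, Int.natAbs_zero] at hdet; omega
  set Bℝ : Matrix (Fin m) (Fin m) ℝ := B.map (Int.cast : ℤ → ℝ) with hBℝ
  have hdetℝ : Bℝ.det = (B.det : ℝ) := by rw [hBℝ]; norm_cast
  have hdetℝ0 : Bℝ.det ≠ 0 := by rw [hdetℝ]; exact_mod_cast hdet0
  set T : (Fin m → ℝ) →ₗ[ℝ] (Fin m → ℝ) := Matrix.toLin' Bℝ with hT
  have hTdet : LinearMap.det T = Bℝ.det := by rw [hT, LinearMap.det_toLin']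
  have hTinj : Function.Injective T := by
    rw [hT]
    exact Matrix.mulVec_injective_iff_isUnit.mpr
      ((Matrix.isUnit_iff_isUnit_det _).mpr (isUnit_iff_ne_zero.mpr hdetℝ0))
  -- the weighted norm and its transport
  obtain ⟨F, hF, hF0⟩ := exists_seminorm_weighted w hw
  let N : Seminorm ℝ (Fin m → ℝ) := F.comp T
  have N_apply : ∀ x, N x = F (T x) := fun x => rfl
  have hN : ∀ x, N x = 0 → x = 0 := fun x hx => by
    rw [N_apply] at hx
    exact hTinj (by rw [hF0 _ hx, map_zero])
  obtain ⟨v, hli, hmono, -, hvol⟩ := exists_directional_system_prod_mul_volume_le hm N hN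
  obtain ⟨y, hygen, hyne, hyle⟩ := exists_int_basis_le_of_directional N v hli hmono
  -- the volume of the unit ball of `N`
  have hΩ : 0 < ∏ i, w i := Finset.prod_pos fun i _ => hw i
  have hball : {x : Fin m → ℝ | N x < 1} = T ⁻¹' {x | ∑ i, w i * |x i| < 1} := by
    ext x; simp [N_apply, hF]
  have hvolN : volume {x : Fin m → ℝ | N x < 1} =
      ENNReal.ofReal |(Bℝ.det)⁻¹| * ENNReal.ofReal (2 ^ m / (m.factorial * ∏ i, w i)) := by
    rw [hball, MeasureTheory.Measure.addHaar_preimage_linearMap volume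
      (by rw [hTdet]; exact hdetℝ0), hTdet, volume_weighted_lt_one w hw]
  -- `∏ N(v_k) ≤ m! |det B| ∏ w`
  set P : ℝ := ∏ k, N (fun i => (v k i : ℝ)) with hP
  have hP0 : 0 ≤ P := Finset.prod_nonneg fun k _ => apply_nonneg _ _
  have hD0 : 0 < |Bℝ.det| := abs_pos.mpr hdetℝ0
  have hPle : P ≤ (m.factorial : ℝ) * |Bℝ.det| * ∏ i, w i := by
    rw [hvolN] at hvol
    have h2m : (2 : ENNReal) ^ m = ENNReal.ofReal ((2 : ℝ) ^ m) := by
      rw [ENNReal.ofReal_pow (by norm_num), ENNReal.ofReal_ofNat]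
    rw [h2m, ← ENNReal.ofReal_mul (abs_nonneg _), ← ENNReal.ofReal_mul hP0,
      ENNReal.ofReal_le_ofReal_iff (by positivity)] at hvol
    rw [abs_inv] at hvol
    -- `hvol : P * (|det|⁻¹ * (2^m / (m! ∏ w))) ≤ 2^m`
    have hfac : (0 : ℝ) < m.factorial := by exact_mod_cast Nat.factorial_pos m
    have h3 : P * (2 : ℝ) ^ m ≤ (m.factorial : ℝ) * |Bℝ.det| * (∏ i, w i) * 2 ^ m := by
      have := mul_le_mul_of_nonneg_left hvol
        (show (0 : ℝ) ≤ (m.factorial : ℝ) * |Bℝ.det| * ∏ i, w i by positivity)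
      calc P * (2 : ℝ) ^ m
          = (m.factorial : ℝ) * |Bℝ.det| * (∏ i, w i) *
              (P * (|Bℝ.det|⁻¹ * (2 ^ m / (m.factorial * ∏ i, w i)))) := by
            field_simp
        _ ≤ (m.factorial : ℝ) * |Bℝ.det| * (∏ i, w i) * 2 ^ m := this
    exact le_of_mul_le_mul_right h3 (by positivity)
  -- `∏ N(y_j) ≤ m! ∏ N(v_k)`
  have hyprod : ∏ j, N (fun i => (y j i : ℝ)) ≤ (m.factorial : ℝ) * P := by
    calc ∏ j, N (fun i => (y j i : ℝ))
        ≤ ∏ j : Fin m, (((j : ℕ) : ℝ) + 1) * N (fun i => (v j i : ℝ)) :=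
          Finset.prod_le_prod (fun j _ => apply_nonneg _ _) fun j _ => hyle j
      _ = (∏ j : Fin m, (((j : ℕ) : ℝ) + 1)) * ∏ j, N (fun i => (v j i : ℝ)) :=
          Finset.prod_mul_distrib
      _ = (m.factorial : ℝ) * P := by
          rw [hP]
          congr 1
          rw [Fin.prod_univ_eq_prod_range (fun j => ((j : ℝ) + 1)) m]
          exact_mod_cast Finset.prod_range_add_one_eq_factorial m
  -- the basis `y` of `ℤ^m` and the basis `b = B y` of `L`
  let yB : Module.Basis (Fin m) ℤ (Fin m → ℤ) :=
    basisOfTopLeSpanOfCardEqFinrank y hygen.ge (by simp)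
  have hyB : ∀ j, yB j = y j := fun j => by
    simp [yB, coe_basisOfTopLeSpanOfCardEqFinrank]
  let b : Module.Basis (Fin m) ℤ L := yB.map bN.equivFun.symm
  have hb : ∀ j, ((b j : L) : Fin m → ℤ) = B.mulVec (y j) := by
    intro j
    have h1 : (b j : L) = bN.equivFun.symm (y j) := by
      rw [Module.Basis.map_apply, hyB]
    rw [h1, Module.Basis.equivFun_symm_apply, Submodule.coe_sum]
    ext i
    simp [Matrix.mulVec, dotProduct, hB, Finset.sum_apply, mul_comm]
  have hnorm : ∀ j, ∑ i, w i * |(((b j : L) : Fin m → ℤ) i : ℝ)| = N (fun i => (y j i : ℝ)) := by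
    intro j
    rw [N_apply, hF, hT, Matrix.toLin'_apply]
    refine Finset.sum_congr rfl fun i _ => ?_
    congr 2
    rw [hb j]
    have := RingHom.map_mulVec (Int.castRingHom ℝ) B (y j) i
    simpa [hBℝ, Function.comp_def] using this
  refine ⟨b, ?_⟩
  calc ∏ j, (∑ i, w i * |(((b j : L) : Fin m → ℤ) i : ℝ)|)
      = ∏ j, N (fun i => (y j i : ℝ)) := Finset.prod_congr rfl fun j _ => hnorm j
    _ ≤ (m.factorial : ℝ) * P := hyprod
    _ ≤ (m.factorial : ℝ) * ((m.factorial : ℝ) * |Bℝ.det| * ∏ i, w i) :=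
        mul_le_mul_of_nonneg_left hPle (by positivity)
    _ = (m.factorial : ℝ) ^ 2 * Nat.card ((Fin m → ℤ) ⧸ L) * ∏ i, w i := by
        rw [hdetℝ, ← Int.cast_abs, ← hdet, Nat.cast_natAbs]; ring

end Summit.ABC.StewartYu.PrincipalLattice

end
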